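import Mathlib
import Summits.NavierStokesRegularity.NavierStokesRegularity.Theorems.EulerZoomLiouvillePowerGaugeEulerLiouvilleSelfSimilarThinSetsC2a
import Summits.NavierStokesRegularity.NavierStokesRegularity.Theorems.EulerZoomLiouvillePowerGaugeEulerLiouvilleSelfSimilarDefectiveNodeThin
import HarnessLib.Audit

/-!
# Rung C1 of the crux `EulerZoomLiouville.PowerGaugeEulerLiouville` (W1 stage S4b): null trapped sets from two-sided RATES and the two
# DEFECTIVE spectral shapes — FOR `C²` PROFILES

Route №10 `EulerZoomLiouville` (NavierStokesRegularity), crux E = stmt-NavierStokesRegularity-19832, tenure rung C1,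
registered residue `stub_selfSimilarExtremalRest`, sub-stratum W1 («`C²` but not `C^∞` profiles»).  Lineage ns-typeII-p2 (gen 8,
INTERIM LEAD).  `C²` twins (namespace `…PowerGaugeEulerLiouville.C2.Kelvin`, same short names as ns-typeII-p3's `…Kelvin`
originals, proofs verbatim) on the `C²` flow API `…SelfSimilarKelvinFlowC2` (S1: joint `C²` flow, `C²` variational equation).
WHAT THIS IS NOT: not NS, not E, not rung C1 — thin-basin lemmas for `C²` profiles with bounded gradient.
[folklore; ConstantinIgnatovaVicol2026Putative §3.5 (setting); Robinson 1999 Ch. V (cone/trapped-set arguments, tree form)]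
-/

noncomputable section

-- flat `Theorems/<Route><Decl>…` files of one crux share the namespace of the crux (tree convention)
set_option linter.dupNamespace false

open MeasureTheory Set Filter Topology Metric Function InnerProductSpace
open scoped RealInnerProductSpace NNReal ContDiff Nat

namespace Summit.NavierStokesRegularity.NavierStokesRegularity.Theorems.PowerGaugeEulerLiouville.C2.Kelvin

open Literature.Analysis Literature.Analysis.FluidPDE Literature.Dynamics.FixedPoints
  Literature.Dynamics.TopologicalDynamics
open Summit.NavierStokesRegularity.NavierStokesRegularity.Theorems.PowerGaugeEulerLiouville.Kelvin

variable {γ : ℝ} {V : EuclideanSpace ℝ (Fin 3) → EuclideanSpace ℝ (Fin 3)} {P : EuclideanSpace ℝ (Fin 3) → ℝ}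

/-- **Rates ⇒ null trapped set.**  `V` smooth with `‖DV‖ ≤ K`, `z ∈ 𝒩_W`; if `A = γI + DV(z)` preserves the
complementary subspaces `Es`, `Ec` (`Ec ≠ ⊤`) and for a sampling time `T > 0` one has `‖e^{TA}x‖ ≤ a‖x‖` on `Es`,
`b‖x‖ ≤ ‖e^{TA}x‖` on `Ec` with `a < 1`, `a < b`, then for some `r > 0` the set of points admitting a `Φ_T`-past
history inside `B(z, r)` is null (`D(Φ_T)(z) = e^{TA}` and the dominated cone lemma).
[cite: Robinson1999, Ch. V §5.10.1 (cone estimate, dominated form; proved in the tree)] -/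
theorem exists_trappedSet_null_of_rates (hV : ContDiff ℝ 2 V) {K : ℝ} (hK : ∀ y, ‖fderiv ℝ V y‖ ≤ K)
    {z : EuclideanSpace ℝ (Fin 3)} (hz : z ∈ selfSimilarNodalSet γ 0 V)
    {Es Ec : Submodule ℝ (EuclideanSpace ℝ (Fin 3))} (hcompl : IsCompl Es Ec)
    (hs : ∀ x ∈ Es, (γ • ContinuousLinearMap.id ℝ (EuclideanSpace ℝ (Fin 3)) + fderiv ℝ V z) x ∈ Es)
    (hc : ∀ x ∈ Ec, (γ • ContinuousLinearMap.id ℝ (EuclideanSpace ℝ (Fin 3)) + fderiv ℝ V z) x ∈ Ec)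
    (hEc : Ec ≠ ⊤) {T a b : ℝ} (hT : 0 < T) (ha1 : a < 1) (hab : a < b)
    (hcon : ∀ x ∈ Es,
      ‖NormedSpace.exp (T • (γ • ContinuousLinearMap.id ℝ (EuclideanSpace ℝ (Fin 3)) + fderiv ℝ V z)) x‖ ≤ a * ‖x‖)
    (hdom : ∀ x ∈ Ec,
      b * ‖x‖ ≤ ‖NormedSpace.exp (T • (γ • ContinuousLinearMap.id ℝ (EuclideanSpace ℝ (Fin 3)) + fderiv ℝ V z)) x‖) :
    ∃ T : ℝ, 0 < T ∧ ∃ r : ℝ, 0 < r ∧ volume {q : EuclideanSpace ℝ (Fin 3) | ∃ qs : ℕ → EuclideanSpace ℝ (Fin 3),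
      qs 0 = q ∧ (∀ k, ODE.evolutionMap (fun _ : ℝ => selfSimilarTransport γ 0 V) 0 T (qs (k + 1)) = qs k) ∧
        ∀ k, qs k ∈ ball z r} = 0 := by
  set A : EuclideanSpace ℝ (Fin 3) →L[ℝ] EuclideanSpace ℝ (Fin 3) :=
    γ • ContinuousLinearMap.id ℝ (EuclideanSpace ℝ (Fin 3)) + fderiv ℝ V z with hA
  have hexp := fderiv_flow_eq_exp_smul hV hK hz T
  have hF : ContDiff ℝ 1 (ODE.evolutionMap (fun _ : ℝ => selfSimilarTransport γ 0 V) 0 T) :=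
    (contDiff_flow (γ := γ) hV hK T).of_le (by norm_cast)
  obtain ⟨r, hr, hnull⟩ := hausdorffMeasure_localTrappedSet_eq_zero_of_dominated (p := z) hF hcompl
    (fun x hx => by rw [hexp]; exact exp_smul_apply_mem A hs hx T)
    (fun x hx => by rw [hexp]; exact exp_smul_apply_mem A hc hx T) ha1 hab
    (fun x hx => by rw [hexp]; exact hcon x hx) (fun x hx => by rw [hexp]; exact hdom x hx) hEc
  exact ⟨T, hT, r, hr,
    (Measure.absolutelyContinuous_isAddHaarMeasure volume (μH[Module.finrank ℝ (EuclideanSpace ℝ (Fin 3))])) hnull⟩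

/-- **Thin shape «eigenline below a double root».**  `V` smooth with `‖DV‖ ≤ K`, `z ∈ 𝒩_W`, `A = γI + DV(z)`.
Suppose `A v₁ = r₁ v₁` with `v₁ ≠ 0`, `r₁ < 0`, `r₁ < λ₁`, and `(A − r₁)(A − λ₁)² = 0` (the characteristic
polynomial is `(X − r₁)(X − λ₁)²`; the eigenvalue `λ₁` may be DEFECTIVE).  Then for some `T > 0`, `r > 0` the set
of points admitting a `Φ_T`-past history inside `B(z, r)` is null: `Es = ker(A − r₁)` with rate `e^{r₁T}`,
`Ec = ker(A − λ₁)²` with lower rate `e^{λ₁T}/(1 + T‖A − λ₁‖)` (`e^{TA}x = e^{Tλ₁}(x + T(A − λ₁)x)` there).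
[cite: Robinson1999, Ch. V §5.10.1 (cone estimate, dominated form; proved in the tree); Khalil2002, §4.3 eq. (4.11)] -/
theorem exists_trappedSet_null_of_eigenline_lt_doubleRoot (hV : ContDiff ℝ 2 V) {K : ℝ}
    (hK : ∀ y, ‖fderiv ℝ V y‖ ≤ K) {z : EuclideanSpace ℝ (Fin 3)} (hz : z ∈ selfSimilarNodalSet γ 0 V)
    {r₁ lam₁ : ℝ} {v₁ : EuclideanSpace ℝ (Fin 3)} (hv₁ : v₁ ≠ 0)
    (hAv₁ : (γ • ContinuousLinearMap.id ℝ (EuclideanSpace ℝ (Fin 3)) + fderiv ℝ V z) v₁ = r₁ • v₁)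
    (hr₁ : r₁ < 0) (hr₁lam : r₁ < lam₁)
    (hfac : ∀ x : EuclideanSpace ℝ (Fin 3),
      (γ • ContinuousLinearMap.id ℝ (EuclideanSpace ℝ (Fin 3)) + fderiv ℝ V z)
        (((γ • ContinuousLinearMap.id ℝ (EuclideanSpace ℝ (Fin 3)) + fderiv ℝ V z) - lam₁ • 1)
          (((γ • ContinuousLinearMap.id ℝ (EuclideanSpace ℝ (Fin 3)) + fderiv ℝ V z) - lam₁ • 1) x)) =
      r₁ • (((γ • ContinuousLinearMap.id ℝ (EuclideanSpace ℝ (Fin 3)) + fderiv ℝ V z) - lam₁ • 1)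
          (((γ • ContinuousLinearMap.id ℝ (EuclideanSpace ℝ (Fin 3)) + fderiv ℝ V z) - lam₁ • 1) x))) :
    ∃ T : ℝ, 0 < T ∧ ∃ r : ℝ, 0 < r ∧ volume {q : EuclideanSpace ℝ (Fin 3) | ∃ qs : ℕ → EuclideanSpace ℝ (Fin 3),
      qs 0 = q ∧ (∀ k, ODE.evolutionMap (fun _ : ℝ => selfSimilarTransport γ 0 V) 0 T (qs (k + 1)) = qs k) ∧
        ∀ k, qs k ∈ ball z r} = 0 := by
  set A : EuclideanSpace ℝ (Fin 3) →L[ℝ] EuclideanSpace ℝ (Fin 3) :=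
    γ • ContinuousLinearMap.id ℝ (EuclideanSpace ℝ (Fin 3)) + fderiv ℝ V z with hA
  set M : EuclideanSpace ℝ (Fin 3) →L[ℝ] EuclideanSpace ℝ (Fin 3) := A - lam₁ • 1 with hM
  have hMapp : ∀ x, M x = A x - lam₁ • x := fun x => rfl
  set c : ℝ := (r₁ - lam₁) ^ 2 with hc
  have hc0 : c ≠ 0 := pow_ne_zero 2 (sub_ne_zero.2 (ne_of_lt hr₁lam))
  -- the splitting
  set Es : Submodule ℝ (EuclideanSpace ℝ (Fin 3)) := LinearMap.ker ((A - r₁ • 1 : EuclideanSpace ℝ (Fin 3) →L[ℝ]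
    EuclideanSpace ℝ (Fin 3)) : EuclideanSpace ℝ (Fin 3) →ₗ[ℝ] EuclideanSpace ℝ (Fin 3)) with hEs
  set Ec : Submodule ℝ (EuclideanSpace ℝ (Fin 3)) :=
    LinearMap.ker ((M * M : EuclideanSpace ℝ (Fin 3) →L[ℝ] EuclideanSpace ℝ (Fin 3)) :
      EuclideanSpace ℝ (Fin 3) →ₗ[ℝ] EuclideanSpace ℝ (Fin 3)) with hEc
  have hmemEs : ∀ x, x ∈ Es ↔ A x = r₁ • x := fun x => by
    rw [hEs, LinearMap.mem_ker]
    change A x - r₁ • x = 0 ↔ _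
    rw [sub_eq_zero]
  have hmemEc : ∀ x, x ∈ Ec ↔ M (M x) = 0 := fun x => by rw [hEc, LinearMap.mem_ker]; rfl
  -- `M` on `Es` and `M²` on `M²x`
  have hMEs : ∀ x ∈ Es, M x = (r₁ - lam₁) • x := fun x hx => by
    rw [hMapp, (hmemEs x).1 hx, sub_smul]
  have hMMM : ∀ x, M (M (M (M x))) = c • M (M x) := by
    intro x
    have h1 : M (M (M x)) = (r₁ - lam₁) • M (M x) := by
      rw [hMapp (M (M x)), hfac x, sub_smul]
    rw [h1, map_smul, h1, smul_smul, hc, sq]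
  have hcompl : IsCompl Es Ec := by
    refine isCompl_iff.2 ⟨Submodule.disjoint_def.2 fun x hxs hxc => ?_, codisjoint_iff.2 (Submodule.eq_top_iff'.2 fun x => ?_)⟩
    · have h1 : M (M x) = c • x := by rw [hMEs x hxs, map_smul, hMEs x hxs, smul_smul, hc, sq]
      rw [(hmemEc x).1 hxc] at h1
      exact (smul_eq_zero.1 h1.symm).resolve_left hc0
    · refine Submodule.mem_sup.2 ⟨c⁻¹ • M (M x), ?_, x - c⁻¹ • M (M x), ?_, by abel⟩
      · rw [hmemEs, map_smul, hfac x, smul_comm]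
      · rw [hmemEc, map_sub, map_sub, map_smul, map_smul, hMMM, smul_smul, inv_mul_cancel₀ hc0, one_smul, sub_self]
  have hAM : ∀ x, A (M x) = M (A x) := fun x => by
    rw [hMapp, hMapp, map_sub, map_smul]
  have hs : ∀ x ∈ Es, A x ∈ Es := fun x hx => by
    rw [hmemEs] at hx ⊢; rw [hx, map_smul, hx]
  have hcE : ∀ x ∈ Ec, A x ∈ Ec := fun x hx => by
    rw [hmemEc] at hx ⊢; rw [← hAM, ← hAM, hx, map_zero]
  have hEcne : Ec ≠ ⊤ := by
    intro htop
    have hv : v₁ ∈ Ec := htop ▸ Submodule.mem_top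
    exact hv₁ (Submodule.disjoint_def.1 hcompl.disjoint v₁ ((hmemEs v₁).2 hAv₁) hv)
  -- sampling time
  obtain ⟨T, hT0, hT⟩ := exists_one_add_mul_lt_exp (κ := lam₁ - r₁) (sub_pos.2 hr₁lam) (norm_nonneg M)
  have h1T : 0 < 1 + T * ‖M‖ := by positivity
  refine exists_trappedSet_null_of_rates hV hK hz hcompl hs hcE hEcne hT0 (a := Real.exp (T * r₁))
    (b := Real.exp (T * lam₁) / (1 + T * ‖M‖)) ?_ ?_ (fun x hx => ?_) (fun x hx => ?_)
  · calc Real.exp (T * r₁) < Real.exp 0 := Real.exp_lt_exp.2 (by nlinarith)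
      _ = 1 := Real.exp_zero
  · rw [lt_div_iff₀ h1T]
    calc Real.exp (T * r₁) * (1 + T * ‖M‖) < Real.exp (T * r₁) * Real.exp ((lam₁ - r₁) * T) :=
          mul_lt_mul_of_pos_left hT (Real.exp_pos _)
      _ = Real.exp (T * lam₁) := by rw [← Real.exp_add]; ring_nf
  · -- `e^{TA}x = e^{Tr₁}x` on the eigenline
    have hx' := (hmemEs x).1 hx
    have hsq : (A - r₁ • (1 : EuclideanSpace ℝ (Fin 3) →L[ℝ] EuclideanSpace ℝ (Fin 3)))
        ((A - r₁ • (1 : EuclideanSpace ℝ (Fin 3) →L[ℝ] EuclideanSpace ℝ (Fin 3))) x) = 0 := by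
      have h0 : (A - r₁ • (1 : EuclideanSpace ℝ (Fin 3) →L[ℝ] EuclideanSpace ℝ (Fin 3))) x = 0 := by
        change A x - r₁ • x = 0; rw [hx', sub_self]
      rw [h0, map_zero]
    rw [exp_smul_apply_of_sq_sub_eq_zero A hsq T]
    change ‖Real.exp (T * r₁) • (x + T • (A x - r₁ • x))‖ ≤ _
    rw [hx', sub_self, smul_zero, add_zero, norm_smul, Real.norm_of_nonneg (Real.exp_pos _).le]
  · -- `e^{TA}x = e^{Tλ₁}(x + TMx)` on `ker M²`
    have hx' := (hmemEc x).1 hx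
    rw [exp_smul_apply_of_sq_sub_eq_zero A (μ := lam₁) hx' T, norm_smul, Real.norm_of_nonneg (Real.exp_pos _).le,
      div_mul_eq_mul_div, div_le_iff₀ h1T]
    calc Real.exp (T * lam₁) * ‖x‖ ≤ Real.exp (T * lam₁) * ((1 + T * ‖M‖) * ‖x + T • M x‖) :=
          mul_le_mul_of_nonneg_left (norm_le_mul_norm_add_smul_apply M hx' hT0.le) (Real.exp_pos _).le
      _ = Real.exp (T * lam₁) * ‖x + T • M x‖ * (1 + T * ‖M‖) := by ring

/-- **Thin shape «double root below an eigenline».**  `V` smooth with `‖DV‖ ≤ K`, `z ∈ 𝒩_W`, `A = γI + DV(z)`.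
Suppose `r₁ < 0`, `r₁ < λ₁`, `A ≠ λ₁ I`, and `(A − λ₁)(A − r₁)² = 0` (characteristic polynomial `(X − λ₁)(X − r₁)²`;
the eigenvalue `r₁` may be DEFECTIVE).  Then for some `T > 0`, `r > 0` the set of points admitting a `Φ_T`-past
history inside `B(z, r)` is null: `Es = ker(A − r₁)²` with rate `e^{r₁T}(1 + T‖A − r₁‖)`, `Ec = ker(A − λ₁)` with
rate `e^{λ₁T}`. [cite: Robinson1999, Ch. V §5.10.1 (cone estimate, dominated form; proved in the tree); Khalil2002, §4.3 eq. (4.11)] -/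
theorem exists_trappedSet_null_of_doubleRoot_lt_eigenline (hV : ContDiff ℝ 2 V) {K : ℝ}
    (hK : ∀ y, ‖fderiv ℝ V y‖ ≤ K) {z : EuclideanSpace ℝ (Fin 3)} (hz : z ∈ selfSimilarNodalSet γ 0 V)
    {r₁ lam₁ : ℝ} (hr₁ : r₁ < 0) (hr₁lam : r₁ < lam₁)
    (hne : ∃ x : EuclideanSpace ℝ (Fin 3),
      (γ • ContinuousLinearMap.id ℝ (EuclideanSpace ℝ (Fin 3)) + fderiv ℝ V z) x ≠ lam₁ • x)
    (hfac : ∀ x : EuclideanSpace ℝ (Fin 3),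
      (γ • ContinuousLinearMap.id ℝ (EuclideanSpace ℝ (Fin 3)) + fderiv ℝ V z)
        (((γ • ContinuousLinearMap.id ℝ (EuclideanSpace ℝ (Fin 3)) + fderiv ℝ V z) - r₁ • 1)
          (((γ • ContinuousLinearMap.id ℝ (EuclideanSpace ℝ (Fin 3)) + fderiv ℝ V z) - r₁ • 1) x)) =
      lam₁ • (((γ • ContinuousLinearMap.id ℝ (EuclideanSpace ℝ (Fin 3)) + fderiv ℝ V z) - r₁ • 1)
          (((γ • ContinuousLinearMap.id ℝ (EuclideanSpace ℝ (Fin 3)) + fderiv ℝ V z) - r₁ • 1) x))) :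
    ∃ T : ℝ, 0 < T ∧ ∃ r : ℝ, 0 < r ∧ volume {q : EuclideanSpace ℝ (Fin 3) | ∃ qs : ℕ → EuclideanSpace ℝ (Fin 3),
      qs 0 = q ∧ (∀ k, ODE.evolutionMap (fun _ : ℝ => selfSimilarTransport γ 0 V) 0 T (qs (k + 1)) = qs k) ∧
        ∀ k, qs k ∈ ball z r} = 0 := by
  set A : EuclideanSpace ℝ (Fin 3) →L[ℝ] EuclideanSpace ℝ (Fin 3) :=
    γ • ContinuousLinearMap.id ℝ (EuclideanSpace ℝ (Fin 3)) + fderiv ℝ V z with hA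
  set M : EuclideanSpace ℝ (Fin 3) →L[ℝ] EuclideanSpace ℝ (Fin 3) := A - r₁ • 1 with hM
  have hMapp : ∀ x, M x = A x - r₁ • x := fun x => rfl
  set c : ℝ := (lam₁ - r₁) ^ 2 with hc
  have hc0 : c ≠ 0 := pow_ne_zero 2 (sub_ne_zero.2 (ne_of_gt hr₁lam))
  set Es : Submodule ℝ (EuclideanSpace ℝ (Fin 3)) :=
    LinearMap.ker ((M * M : EuclideanSpace ℝ (Fin 3) →L[ℝ] EuclideanSpace ℝ (Fin 3)) :
      EuclideanSpace ℝ (Fin 3) →ₗ[ℝ] EuclideanSpace ℝ (Fin 3)) with hEs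
  set Ec : Submodule ℝ (EuclideanSpace ℝ (Fin 3)) := LinearMap.ker ((A - lam₁ • 1 : EuclideanSpace ℝ (Fin 3) →L[ℝ]
    EuclideanSpace ℝ (Fin 3)) : EuclideanSpace ℝ (Fin 3) →ₗ[ℝ] EuclideanSpace ℝ (Fin 3)) with hEc
  have hmemEc : ∀ x, x ∈ Ec ↔ A x = lam₁ • x := fun x => by
    rw [hEc, LinearMap.mem_ker]
    change A x - lam₁ • x = 0 ↔ _
    rw [sub_eq_zero]
  have hmemEs : ∀ x, x ∈ Es ↔ M (M x) = 0 := fun x => by rw [hEs, LinearMap.mem_ker]; rfl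
  have hMEc : ∀ x ∈ Ec, M x = (lam₁ - r₁) • x := fun x hx => by
    rw [hMapp, (hmemEc x).1 hx, sub_smul]
  have hMMM : ∀ x, M (M (M (M x))) = c • M (M x) := by
    intro x
    have h1 : M (M (M x)) = (lam₁ - r₁) • M (M x) := by
      rw [hMapp (M (M x)), hfac x, sub_smul]
    rw [h1, map_smul, h1, smul_smul, hc, sq]
  have hcompl : IsCompl Es Ec := by
    refine isCompl_iff.2 ⟨Submodule.disjoint_def.2 fun x hxs hxc => ?_, codisjoint_iff.2 (Submodule.eq_top_iff'.2 fun x => ?_)⟩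
    · have h1 : M (M x) = c • x := by rw [hMEc x hxc, map_smul, hMEc x hxc, smul_smul, hc, sq]
      rw [(hmemEs x).1 hxs] at h1
      exact (smul_eq_zero.1 h1.symm).resolve_left hc0
    · refine Submodule.mem_sup.2 ⟨x - c⁻¹ • M (M x), ?_, c⁻¹ • M (M x), ?_, by abel⟩
      · rw [hmemEs, map_sub, map_sub, map_smul, map_smul, hMMM, smul_smul, inv_mul_cancel₀ hc0, one_smul, sub_self]
      · rw [hmemEc, map_smul, hfac x, smul_comm]
  have hAM : ∀ x, A (M x) = M (A x) := fun x => by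
    rw [hMapp, hMapp, map_sub, map_smul]
  have hsE : ∀ x ∈ Es, A x ∈ Es := fun x hx => by
    rw [hmemEs] at hx ⊢; rw [← hAM, ← hAM, hx, map_zero]
  have hcE : ∀ x ∈ Ec, A x ∈ Ec := fun x hx => by
    rw [hmemEc] at hx ⊢; rw [hx, map_smul, hx]
  have hEcne : Ec ≠ ⊤ := by
    intro htop
    obtain ⟨x, hx⟩ := hne
    exact hx ((hmemEc x).1 (htop ▸ Submodule.mem_top))
  -- sampling time from `κ = min(−r₁, λ₁ − r₁)`
  set κ : ℝ := min (-r₁) (lam₁ - r₁) with hκ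
  have hκ0 : 0 < κ := lt_min (neg_pos.2 hr₁) (sub_pos.2 hr₁lam)
  obtain ⟨T, hT0, hT⟩ := exists_one_add_mul_lt_exp hκ0 (norm_nonneg M)
  have h1T : 0 < 1 + T * ‖M‖ := by positivity
  have hT1 : 1 + T * ‖M‖ < Real.exp (-r₁ * T) :=
    hT.trans_le (Real.exp_le_exp.2 (mul_le_mul_of_nonneg_right (min_le_left _ _) hT0.le))
  have hT2 : 1 + T * ‖M‖ < Real.exp ((lam₁ - r₁) * T) :=
    hT.trans_le (Real.exp_le_exp.2 (mul_le_mul_of_nonneg_right (min_le_right _ _) hT0.le))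
  refine exists_trappedSet_null_of_rates hV hK hz hcompl hsE hcE hEcne hT0
    (a := Real.exp (T * r₁) * (1 + T * ‖M‖)) (b := Real.exp (T * lam₁)) ?_ ?_ (fun x hx => ?_) (fun x hx => ?_)
  · have h2 : Real.exp (T * r₁) * Real.exp (-r₁ * T) = 1 := by rw [← Real.exp_add]; ring_nf; exact Real.exp_zero
    calc Real.exp (T * r₁) * (1 + T * ‖M‖) < Real.exp (T * r₁) * Real.exp (-r₁ * T) :=
          mul_lt_mul_of_pos_left hT1 (Real.exp_pos _)
      _ = 1 := h2
  · calc Real.exp (T * r₁) * (1 + T * ‖M‖) < Real.exp (T * r₁) * Real.exp ((lam₁ - r₁) * T) :=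
          mul_lt_mul_of_pos_left hT2 (Real.exp_pos _)
      _ = Real.exp (T * lam₁) := by rw [← Real.exp_add]; ring_nf
  · have hx' := (hmemEs x).1 hx
    rw [exp_smul_apply_of_sq_sub_eq_zero A (μ := r₁) hx' T, norm_smul, Real.norm_of_nonneg (Real.exp_pos _).le,
      mul_assoc]
    exact mul_le_mul_of_nonneg_left (norm_add_smul_apply_le M x hT0.le) (Real.exp_pos _).le
  · have hx' := (hmemEc x).1 hx
    have hsq : (A - lam₁ • (1 : EuclideanSpace ℝ (Fin 3) →L[ℝ] EuclideanSpace ℝ (Fin 3)))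
        ((A - lam₁ • (1 : EuclideanSpace ℝ (Fin 3) →L[ℝ] EuclideanSpace ℝ (Fin 3))) x) = 0 := by
      have h0 : (A - lam₁ • (1 : EuclideanSpace ℝ (Fin 3) →L[ℝ] EuclideanSpace ℝ (Fin 3))) x = 0 := by
        change A x - lam₁ • x = 0; rw [hx', sub_self]
      rw [h0, map_zero]
    rw [exp_smul_apply_of_sq_sub_eq_zero A hsq T]
    change _ ≤ ‖Real.exp (T * lam₁) • (x + T • (A x - lam₁ • x))‖
    rw [hx', sub_self, smul_zero, add_zero, norm_smul, Real.norm_of_nonneg (Real.exp_pos _).le]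

end Summit.NavierStokesRegularity.NavierStokesRegularity.Theorems.PowerGaugeEulerLiouville.C2.Kelvin

end
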